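import Summits.AtomisticToContinuum.FouriersLaw.Theorems.VanishingNoiseTransferVanishingNoiseBoundFlipAsymmetryTransferPinned

/-!
# (UA) from uniform exponential convergence of the flip-free semigroup near equilibrium
(helper for stub S2a `stub_uniformAsymmetryTransfer`, line `fekete-usc-one-length`)

`--supports stmt-AtomisticToContinuum-11976` helper file (crux `VanishingNoiseBound`). The landed
fixed-temperature transfer bound `exists_flipSteadyState_totalCurrent_sub_le_of_flipAsymmetry`
(`…FlipAsymmetryTransferPinned.lean`) has `K = 2MN²K_j`, `ε₀ = min(1/N, 1/(2MN+1))`, whose only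
non-explicit input is `M = C/c`, `(C, c)` the constants of CEHR 2018 (2.5)
`|P_t f(z) - μ⋆(f)| ≤ C e^{θH(z)} e^{-ct}` for the flip-free transition kernels. This file re-runs the
landed steps with the weight `θ` free and `(C, c)` as INPUT
(`exists_resolventKernel_invariant_of_expConvergence`,
`exists_flipSteadyState_totalCurrent_sub_le_of_expConvergence`), and concludes
`uniformAsymmetryTransfer_of_uniformExpConvergence`: the stub's (UA) follows from (UEC) — (2.5) with
constants UNIFORM for the temperatures `(T+δ/2, T-δ/2)`, `|δ| < δ₀`, at one weight `θ` with
`θ(2T+δ₀) ≤ 1` (so `θ ≤ θ_δ`; the stub's test class at `θ_δ` contains the one at `θ`). So the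
residual of S2a is exactly (UEC): temperature-uniform Harris constants of the deterministic chain
near equilibrium. No definitions.
-/

noncomputable section

namespace Summit.AtomisticToContinuum.FouriersLaw.Theorems.FixedLengthNoiseContinuity

open MeasureTheory ProbabilityTheory Filter Topology Set
open scoped NNReal ENNReal ContDiff BoundedContinuousFunction
open Literature.MathematicalPhysics.KineticTheory.HeatConduction
open Literature.Probability.Process

/-! ## §1 The resolvent kernels from a given exponential convergence -/

section Pinned

variable {ω₂ lam β γ : ℝ} {N : ℕ} {T_L T_R : ℝ}

/-- **The resolvent kernels `R_r`, `r ≤ 1`, with an EXPLICIT contraction constant** (`N ≥ 2`,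
`T_L, T_R > 0`, weight `0 < θ < 1/max(T_L,T_R)`; hypothesis: every invariant probability measure `μ`
of the transition kernels obeys `|P_t f(z) - μ(f)| ≤ C e^{θH(z)} e^{-ct}` on continuous
`|f| ≤ e^{θH}`): the steady state `μ⋆` (probability, weak `IsSteadyState`, `∫e^{θH}dμ⋆ < ∞`),
`a < 1`, `b < ∞`, and for `0 < r ≤ 1` a Markov kernel `R` with `μ⋆ R = μ⋆`, the resolvent identity
on `C_c^∞`, Feller, `R e^{θH} ≤ a e^{θH} + b` and `|R g(z) - μ⋆(g)| ≤ (C/c) r e^{θH(z)}`. Proof: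
`exists_resolventKernel_invariant` (`…FlipResolventInvariant.lean`) verbatim, `θ` free, (2.5) from
the hypothesis. -/
theorem exists_resolventKernel_invariant_of_expConvergence (hω : 0 < ω₂) (hl : 0 < lam)
    (hβ : 0 < β) (hγ : 0 < γ) (hN : 1 < N) (hTL : 0 < T_L) (hTR : 0 < T_R) {θ : ℝ} (hθ : 0 < θ)
    (hθ' : θ < 1 / max T_L T_R) {C c : ℝ} (hC : 0 ≤ C) (hc : 0 < c)
    (h25 : ∀ μ : Measure (PhaseSpace N), IsProbabilityMeasure μ →
      (∀ t : ℝ≥0, μ.bind ((pinnedChain ω₂ lam β γ).transitionKernel N T_L T_R t) = μ) →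
      ∀ (z : PhaseSpace N) (t : ℝ≥0) (f : PhaseSpace N → ℝ), Continuous f →
        (∀ y, |f y| ≤ Real.exp (θ * (pinnedChain ω₂ lam β γ).hamiltonian N y)) →
        |∫ y, f y ∂((pinnedChain ω₂ lam β γ).transitionKernel N T_L T_R t z) - ∫ y, f y ∂μ| ≤
          C * Real.exp (θ * (pinnedChain ω₂ lam β γ).hamiltonian N z) * Real.exp (-c * t)) :
    ∃ μs : Measure (PhaseSpace N), IsProbabilityMeasure μs ∧
      (pinnedChain ω₂ lam β γ).IsSteadyState N T_L T_R μs ∧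
      ∫⁻ y, ENNReal.ofReal (Real.exp (θ * (pinnedChain ω₂ lam β γ).hamiltonian N y)) ∂μs ≠ ⊤ ∧
      ∃ (a b : ℝ≥0∞), a < 1 ∧ b ≠ ⊤ ∧
        ∀ r : ℝ, 0 < r → r ≤ 1 →
          ∃ R : Kernel (PhaseSpace N) (PhaseSpace N), IsMarkovKernel R ∧
            μs.bind R = μs ∧
            (∀ f : PhaseSpace N → ℝ, ContDiff ℝ ∞ f → HasCompactSupport f → ∀ z : PhaseSpace N,
              ∫ y, (pinnedChain ω₂ lam β γ).generator N T_L T_R f y ∂(R z) =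
                r * (∫ y, f y ∂(R z) - f z)) ∧
            (∀ g : PhaseSpace N →ᵇ ℝ, Continuous fun z => ∫ y, g y ∂(R z)) ∧
            (∀ z : PhaseSpace N,
              ∫⁻ y, ENNReal.ofReal (Real.exp (θ * (pinnedChain ω₂ lam β γ).hamiltonian N y)) ∂(R z) ≤
                a * ENNReal.ofReal (Real.exp (θ * (pinnedChain ω₂ lam β γ).hamiltonian N z)) + b) ∧
            (∀ g : PhaseSpace N → ℝ, Continuous g →
              (∀ y, |g y| ≤ Real.exp (θ * (pinnedChain ω₂ lam β γ).hamiltonian N y)) →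
              ∀ z : PhaseSpace N, |∫ y, g y ∂(R z) - ∫ y, g y ∂μs| ≤
                C / c * r * Real.exp (θ * (pinnedChain ω₂ lam β γ).hamiltonian N z)) := by
  -- adapted from `exists_resolventKernel_invariant`
  -- (Summits/…/VanishingNoiseTransferVanishingNoiseBoundFlipResolventInvariant.lean): weight `θ` free,
  -- (2.5) constants from the hypothesis `h25`
  have hN0 : 0 < N := by omega
  set P := pinnedChain ω₂ lam β γ
  set Sg := pinnedChainSemigroup hω hl.le hβ.le hγ.le hN0 hTL.le hTR.le
  -- the steady state of the semigroup
  obtain ⟨-, μs, hμs, hinv, hrest⟩ := pinnedChainSemigroup_ergodic hω hl.le hβ hγ hN0 hTL hTR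
  obtain ⟨hint, -⟩ := hrest θ hθ hθ'
  haveI := hμs
  have hss : P.IsSteadyState N T_L T_R μs :=
    pinnedChain_isSteadyState_of_isInvariant hω.le hl.le hβ.le γ N Sg hinv hθ hint
  have hinv' : ∀ t : ℝ≥0, μs.bind (P.transitionKernel N T_L T_R t) = μs := fun t => (hinv t).def
  have h25' := h25 μs hμs hinv'
  -- the time-extended kernel
  let K : Kernel (ℝ × PhaseSpace N) (PhaseSpace N) := ⟨fun p => Sg.kernel p.1.toNNReal p.2,
    Measurable.comp (g := fun q : ℝ≥0 × PhaseSpace N => Sg.kernel q.1 q.2)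
      (f := fun p : ℝ × PhaseSpace N => (p.1.toNNReal, p.2)) Sg.measurable_kernel (by fun_prop)⟩
  haveI hKM : IsMarkovKernel K :=
    ⟨fun p => by change IsProbabilityMeasure (Sg.kernel p.1.toNNReal p.2); infer_instance⟩
  have hK : ∀ (t : ℝ) (z : PhaseSpace N), K (t, z) = Sg.kernel t.toNNReal z := fun t z => rfl
  -- Lyapunov constants, with the time step frozen at `r₀ = 1`
  set Cst : ℝ := θ * γ * (T_L + T_R) with hCst
  have hCst0 : 0 ≤ Cst := by positivity
  set ts : ℝ := 1 / (8 * (Cst + 1 + 1)) with hts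
  have hts0 : 0 < ts := by positivity
  have hkey : (Cst + 1 + 1) * ts = 1 / 8 := by rw [hts]; field_simp
  have hCts : Cst * ts ≤ 1 / 8 := hkey ▸ mul_le_mul_of_nonneg_right (by linarith) hts0.le
  have h1ts : ts ≤ 1 / 8 := hkey ▸ (le_mul_of_one_le_left hts0.le (by linarith))
  set tstar : ℝ≥0 := ⟨ts, hts0.le⟩
  have htsco : ((tstar : ℝ≥0) : ℝ) = ts := rfl
  have hts0' : (0 : ℝ≥0) < tstar := by rw [← NNReal.coe_lt_coe]; exact hts0
  set V : PhaseSpace N → ℝ≥0∞ := fun y => ENNReal.ofReal (Real.exp (θ * P.hamiltonian N y)) with hV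
  have hVm : Measurable V := ENNReal.measurable_ofReal.comp (Real.measurable_exp.comp
    ((pinnedChain_continuous_hamiltonian ω₂ lam β γ N).measurable.const_mul _))
  have h34 := lintegral_exp_mul_hamiltonian_pinnedChainSemigroup_le hω hl.le hβ.le hγ.le hN0 hTL.le
    hTR.le hTL hTR hθ hθ'
  obtain ⟨E₀, hE₀⟩ := pinnedChain_lintegral_exp_hamiltonian_small hω hl hβ hγ hN hTL hTR hθ hθ'
    (tstar := (tstar : ℝ)) (by rw [htsco]; exact hts0)
  set c₀ : ℝ := Real.exp (Cst * ts) * Real.exp (θ * E₀) with hc₀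
  set a₀ : ℝ≥0∞ := ENNReal.ofReal (1 / 2) with ha₀
  have hH2 : ∀ x, ∫⁻ y, V y ∂(Sg.kernel tstar x) ≤ a₀ * V x + ENNReal.ofReal c₀ := by
    intro x
    change ∫⁻ y, V y ∂(P.transitionKernel N T_L T_R tstar x) ≤ _
    by_cases hx : P.hamiltonian N x ≤ E₀
    · refine (h34 tstar x).trans (le_add_left (ENNReal.ofReal_le_ofReal ?_))
      rw [hc₀, htsco]
      exact mul_le_mul_of_nonneg_left (Real.exp_le_exp.2 (mul_le_mul_of_nonneg_left hx hθ.le))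
        (Real.exp_pos _).le
    · rw [pinnedChain_lintegral_transitionKernel hω hl.le hβ.le hγ.le N T_L T_R tstar x hVm]
      refine (hE₀ x (le_of_not_ge hx)).trans (le_add_right (le_of_eq ?_))
      rw [ha₀, hV, ← ENNReal.ofReal_mul (by norm_num)]
      congr 1; ring
  set cc : ℝ≥0∞ := ENNReal.ofReal (Real.exp (Cst * ts)) with hcc
  have hloc : ∀ u : ℝ≥0, u < tstar → ∀ x, ∫⁻ y, V y ∂(Sg.kernel u x) ≤ cc * V x := by
    intro u hu x
    refine (h34 u x).trans ?_
    rw [hcc, hV, ← ENNReal.ofReal_mul (by positivity)]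
    refine ENNReal.ofReal_le_ofReal (mul_le_mul_of_nonneg_right (Real.exp_le_exp.2 ?_) (by positivity))
    have hu' : ((u : ℝ≥0) : ℝ) ≤ ts := by rw [← htsco]; exact_mod_cast hu.le
    rw [hCst]
    nlinarith [u.coe_nonneg]
  have ha₀1 : a₀ < 1 := ENNReal.ofReal_lt_one.2 (by norm_num)
  obtain ⟨B, hBtop, hB⟩ := MarkovSemigroup.exists_fixedBound ha₀1 ENNReal.ofReal_ne_top
  have hunif : ∀ (t : ℝ≥0) x, ∫⁻ y, V y ∂(Sg.kernel t x) ≤ cc * V x + B := fun t x =>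
    MarkovSemigroup.lintegral_kernel_le_of_lyapunov Sg.kernel Sg.kernel_zero Sg.kernel_add hVm hts0'
      ha₀1.le hB hH2 hloc t x
  -- the exponential moment of the steady state
  have hμsV : ∫⁻ y, V y ∂μs ≠ ⊤ := by
    have h := hint.2
    rw [hasFiniteIntegral_iff_enorm] at h
    simp only [Real.enorm_eq_ofReal (Real.exp_nonneg _)] at h
    exact h.ne
  -- the uniform constants
  refine ⟨μs, hμs, hss, hμsV, cc * ENNReal.ofReal ts + cc * a₀, B + (cc * ENNReal.ofReal c₀ + B),
    ?_, ?_, fun r hr hr1 => ?_⟩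
  · rw [hcc, ha₀, ← ENNReal.ofReal_mul (Real.exp_pos _).le, ← ENNReal.ofReal_mul (Real.exp_pos _).le,
      ← ENNReal.ofReal_add (by positivity) (by positivity), ENNReal.ofReal_lt_one]
    have h1 : Real.exp (Cst * ts) * (1 - Cst * ts) ≤ 1 := by
      have := Real.add_one_le_exp (-(Cst * ts))
      calc Real.exp (Cst * ts) * (1 - Cst * ts) ≤ Real.exp (Cst * ts) * Real.exp (-(Cst * ts)) :=
            mul_le_mul_of_nonneg_left (by linarith) (Real.exp_pos _).le
        _ = 1 := by rw [← Real.exp_add, add_neg_cancel, Real.exp_zero]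
    nlinarith [Real.exp_pos (Cst * ts), mul_nonneg hCst0 hts0.le]
  · exact ENNReal.add_ne_top.2 ⟨hBtop, ENNReal.add_ne_top.2
      ⟨ENNReal.mul_ne_top ENNReal.ofReal_ne_top ENNReal.ofReal_ne_top, hBtop⟩⟩
  -- the resolvent kernel at rate `r`
  haveI := isProbabilityMeasure_expMeasure hr
  set ρ := expMeasure r
  have hly : ∀ z : PhaseSpace N, ∫⁻ y, V y ∂((K ∘ₖ (Kernel.const (PhaseSpace N) ρ ×ₖ Kernel.id)) z) ≤
      (cc * ENNReal.ofReal ts + cc * a₀) * V z + (B + (cc * ENNReal.ofReal c₀ + B)) := by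
    intro z
    have h₁ : ∀ t : ℝ, ∫⁻ y, V y ∂(K (t, z)) ≤ cc * V z + B := fun t => hunif t.toNNReal z
    have h₂ : ∀ t : ℝ, ts ≤ t →
        ∫⁻ y, V y ∂(K (t, z)) ≤ cc * a₀ * V z + (cc * ENNReal.ofReal c₀ + B) := fun t ht =>
      Sg.lintegral_kernel_le_of_tstar_le K hK hVm hH2 hunif (by rw [htsco]; exact ht) z
    refine (lintegral_comp_const_prod_id_le K ρ z hVm ts h₁ h₂).trans ?_
    gcongr
    refine (expMeasure_Iio_le hr hts0.le).trans (ENNReal.ofReal_le_ofReal ?_)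
    calc r * ts ≤ 1 * ts := mul_le_mul_of_nonneg_right hr1 hts0.le
      _ = ts := one_mul ts
  refine ⟨K ∘ₖ (Kernel.const (PhaseSpace N) ρ ×ₖ Kernel.id), inferInstance,
    isInvariant_resolvent Sg K hK ρ hinv, fun f hf hfc z =>
    Sg.integral_generator_comp_const_prod_id K hK (pinnedChain_contDiff_U ω₂ lam β γ)
      (pinnedChain_contDiff_V ω₂ lam β γ) hr hf hfc z, fun g => Sg.continuous_integral_comp_const_prod_id
      K hK ρ (continuous_act_pinnedChainSemigroup hω hl.le hβ.le hγ.le hN0 hTL.le hTR.le) g, hly, ?_⟩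
  -- the distance to the steady state, `abs_integral_resolvent_sub_le`
  intro g hg hgb z
  have hVz : ∫⁻ y, V y ∂((K ∘ₖ (Kernel.const (PhaseSpace N) ρ ×ₖ Kernel.id)) z) < ⊤ := by
    refine (hly z).trans_lt (ENNReal.add_lt_top.2 ⟨ENNReal.mul_lt_top ?_ ENNReal.ofReal_lt_top, ?_⟩)
    · exact ENNReal.add_lt_top.2 ⟨ENNReal.mul_lt_top ENNReal.ofReal_lt_top ENNReal.ofReal_lt_top,
        ENNReal.mul_lt_top ENNReal.ofReal_lt_top ENNReal.ofReal_lt_top⟩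
    · exact ENNReal.add_lt_top.2 ⟨hBtop.lt_top, ENNReal.add_lt_top.2
        ⟨ENNReal.mul_lt_top ENNReal.ofReal_lt_top ENNReal.ofReal_lt_top, hBtop.lt_top⟩⟩
  have hexpi : Integrable (fun y => Real.exp (θ * P.hamiltonian N y))
      ((K ∘ₖ (Kernel.const (PhaseSpace N) ρ ×ₖ Kernel.id)) z) := by
    refine ⟨(Real.continuous_exp.comp (continuous_const.mul
      (pinnedChain_continuous_hamiltonian ω₂ lam β γ N))).aestronglyMeasurable, ?_⟩
    show ∫⁻ y, ‖Real.exp (θ * P.hamiltonian N y)‖ₑ ∂((K ∘ₖ (Kernel.const (PhaseSpace N) ρ ×ₖ Kernel.id)) z) < ⊤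
    simpa only [Real.enorm_eq_ofReal (Real.exp_nonneg _)] using hVz
  have hgi : Integrable g ((K ∘ₖ (Kernel.const (PhaseSpace N) ρ ×ₖ Kernel.id)) z) :=
    hexpi.mono' hg.aestronglyMeasurable (Eventually.of_forall fun y => by
      rw [Real.norm_eq_abs]; exact hgb y)
  have hA : 0 ≤ C * Real.exp (θ * P.hamiltonian N z) := by positivity
  refine (abs_integral_resolvent_sub_le Sg K hK hr hg.stronglyMeasurable z hgi hA hc
    fun t => h25' z t g hg hgb).trans ?_
  calc C * Real.exp (θ * P.hamiltonian N z) * (r / (r + c))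
      ≤ C * Real.exp (θ * P.hamiltonian N z) * (r / c) :=
        mul_le_mul_of_nonneg_left (div_le_div_of_nonneg_left hr.le hc (by linarith)) hA
    _ = C / c * r * Real.exp (θ * P.hamiltonian N z) := by ring

/-! ## §2 The transfer with explicit constants -/

/-- **Some flip steady state has current within `K ε A` of that of THE steady state, EXPLICIT
`K, ε₀`** (`N ≥ 2`, (2.5) constants `(C, c)` at weight `θ` given, weak uniqueness of the steady
state as hypothesis): `K = 2(C/c)N·(N K_j)`, `K_j = N((3+β)/2)(2e^θ/θ²)`,
`ε₀ = min(1/N, 1/(2(C/c)N+1))`: `exists_flipSteadyState_sub_le_of_flipAsymmetry` with the resolvent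
kernel `R_{Nε}` (contraction `κ = (C/c)Nε ≤ 1/2`, so `Aκ/(1-κ) ≤ 2κA`) on the dominated bond
currents `|j_i| ≤ K_j e^{θH}` (proof of `exists_flipSteadyState_totalCurrent_sub_le_of_flipAsymmetry`). -/
theorem exists_flipSteadyState_totalCurrent_sub_le_of_expConvergence (hω : 0 < ω₂) (hl : 0 < lam)
    (hβ : 0 < β) (hγ : 0 < γ) (hN : 1 < N) (hTL : 0 < T_L) (hTR : 0 < T_R) {θ : ℝ} (hθ : 0 < θ)
    (hθ' : θ < 1 / max T_L T_R) {C c : ℝ} (hC : 0 ≤ C) (hc : 0 < c)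
    (h25 : ∀ μ : Measure (PhaseSpace N), IsProbabilityMeasure μ →
      (∀ t : ℝ≥0, μ.bind ((pinnedChain ω₂ lam β γ).transitionKernel N T_L T_R t) = μ) →
      ∀ (z : PhaseSpace N) (t : ℝ≥0) (f : PhaseSpace N → ℝ), Continuous f →
        (∀ y, |f y| ≤ Real.exp (θ * (pinnedChain ω₂ lam β γ).hamiltonian N y)) →
        |∫ y, f y ∂((pinnedChain ω₂ lam β γ).transitionKernel N T_L T_R t z) - ∫ y, f y ∂μ| ≤
          C * Real.exp (θ * (pinnedChain ω₂ lam β γ).hamiltonian N z) * Real.exp (-c * t))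
    (μ0 : Measure (PhaseSpace N))
    (hμ0 : (pinnedChain ω₂ lam β γ).IsSteadyState N T_L T_R μ0 ∧
      ∀ ν : Measure (PhaseSpace N), (pinnedChain ω₂ lam β γ).IsSteadyState N T_L T_R ν → ν = μ0) :
    ∀ A : ℝ, 0 ≤ A →
      (∀ (i : Fin N) (h : PhaseSpace N → ℝ), Continuous h →
        (∀ y, |h y| ≤ Real.exp (θ * (pinnedChain ω₂ lam β γ).hamiltonian N y)) →
        |∫ y, h (momentumFlip i y) ∂μ0 - ∫ y, h y ∂μ0| ≤ A) →
      ∀ ε : ℝ, 0 < ε → ε ≤ min (1 / (N : ℝ)) (1 / (2 * (C / c) * N + 1)) →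
        ∃ μ : Measure (PhaseSpace N), (pinnedChain ω₂ lam β γ).IsFlipSteadyState N T_L T_R ε μ ∧
          |(pinnedChain ω₂ lam β γ).totalCurrent μ - (pinnedChain ω₂ lam β γ).totalCurrent μ0| ≤
            (2 * (C / c) * N * (N * (N * ((3 + β) / 2) * (2 * Real.exp θ / θ ^ 2)))) * ε * A := by
  -- adapted from `exists_flipSteadyState_totalCurrent_sub_le_of_flipAsymmetry`
  set P := pinnedChain ω₂ lam β γ with hPdef
  intro A hA hasym ε hε hεle
  have hN0 : 0 < N := by omega
  have hNpos : (0 : ℝ) < N := by exact_mod_cast hN0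
  obtain ⟨μs, hμs, hss, hμsV, a, b, ha, hb, hR⟩ :=
    exists_resolventKernel_invariant_of_expConvergence hω hl hβ hγ hN hTL hTR hθ hθ' hC hc h25
  -- `μ⋆ = μ0` by weak uniqueness
  have hμs0 : μs = μ0 := hμ0.2 μs hss
  rw [← hμs0] at hasym ⊢
  -- domination of the bond currents: `|j_i| ≤ Kj e^{θH}`
  set Kj : ℝ := N * ((3 + β) / 2) * (2 * Real.exp θ / θ ^ 2) with hKj
  have hKj0 : 0 < Kj := by positivity
  have hdom : ∀ (i : Fin N) (x : PhaseSpace N), |P.bondCurrent N i x / Kj| ≤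
      Real.exp (θ * P.hamiltonian N x) := by
    intro i x
    have hH0 := pinnedChain_hamiltonian_nonneg hω.le hl.le hβ.le γ N x
    have hj := pinnedChain_abs_bondCurrent_le hω.le hl.le hβ.le γ N i x
    have hsq := one_add_sq_le_exp hH0 hθ
    rw [abs_div, abs_of_pos hKj0, div_le_iff₀ hKj0]
    calc |P.bondCurrent N i x| ≤ N * ((3 + β) / 2 * (1 + P.hamiltonian N x) ^ 2) := hj
      _ = N * ((3 + β) / 2) * (1 + P.hamiltonian N x) ^ 2 := by ring
      _ ≤ N * ((3 + β) / 2) * (2 * Real.exp θ / θ ^ 2 * Real.exp (θ * P.hamiltonian N x)) :=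
          mul_le_mul_of_nonneg_left hsq (by positivity)
      _ = Real.exp (θ * P.hamiltonian N x) * Kj := by rw [hKj]; ring
  have hεN : (N : ℝ) * ε ≤ 1 := by
    have h := hεle.trans (min_le_left _ _)
    calc (N : ℝ) * ε ≤ N * (1 / N) := mul_le_mul_of_nonneg_left h hNpos.le
      _ = 1 := by field_simp
  have hMε : C / c * ((N : ℝ) * ε) ≤ 1 / 2 := by
    have h := hεle.trans (min_le_right _ _)
    have hden : (0 : ℝ) < 2 * (C / c) * N + 1 := by positivity
    rw [le_div_iff₀ hden] at h
    nlinarith [mul_nonneg (div_nonneg hC hc.le) hNpos.le, hε.le]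
  -- the flip steady state `μ = π R_{Nε}` (`exists_flipSteadyState_sub_le_of_flipAsymmetry`)
  obtain ⟨R, hRM, hinvR, hres, hfel, hly, hdist⟩ := hR ((N : ℝ) * ε) (by positivity) hεN
  haveI := hRM
  have hκ0 : 0 ≤ C / c * ((N : ℝ) * ε) := by positivity
  obtain ⟨μ, hμ, hbound⟩ := exists_flipSteadyState_sub_le_of_flipAsymmetry hω hl.le hβ.le hN0
    T_L T_R ε R hres hfel hθ ha hb hly μs hμsV hinvR hκ0 (by linarith) hdist hA hasym
  have hg : ∀ g : PhaseSpace N → ℝ, Continuous g → (∀ y, |g y| ≤ Real.exp (θ * P.hamiltonian N y)) →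
      |∫ y, g y ∂μ - ∫ y, g y ∂μs| ≤ 2 * (C / c) * ((N : ℝ) * ε) * A := by
    intro g hg hgb
    refine (hbound g hg hgb).trans ?_
    have hAκ : 0 ≤ A * (C / c * ((N : ℝ) * ε)) := mul_nonneg hA hκ0
    calc A * (C / c * ((N : ℝ) * ε)) / (1 - C / c * ((N : ℝ) * ε))
        ≤ A * (C / c * ((N : ℝ) * ε)) / (1 / 2) :=
          div_le_div_of_nonneg_left hAκ (by norm_num) (by linarith)
      _ = 2 * (C / c) * ((N : ℝ) * ε) * A := by ring
  refine ⟨μ, hμ, ?_⟩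
  -- per-bond estimate
  have hbond : ∀ i : Fin N, |∫ x, P.bondCurrent N i x ∂μ - ∫ x, P.bondCurrent N i x ∂μs| ≤
      Kj * (2 * (C / c) * ((N : ℝ) * ε) * A) := by
    intro i
    have h := hg (fun x => P.bondCurrent N i x / Kj)
      ((pinnedChain_continuous_bondCurrent ω₂ lam β γ N i).div_const Kj) (hdom i)
    simp only [integral_div] at h
    rw [← sub_div, abs_div, abs_of_pos hKj0, div_le_iff₀ hKj0] at h
    linarith
  -- sum over the bonds
  have hsum : |P.totalCurrent μ - P.totalCurrent μs| ≤ N * (Kj * (2 * (C / c) * ((N : ℝ) * ε) * A)) := by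
    unfold OscillatorChain.totalCurrent
    rw [← Finset.sum_sub_distrib]
    refine (Finset.abs_sum_le_sum_abs _ _).trans ?_
    calc ∑ i : Fin N, |∫ x, P.bondCurrent N i x ∂μ - ∫ x, P.bondCurrent N i x ∂μs|
        ≤ ∑ _i : Fin N, Kj * (2 * (C / c) * ((N : ℝ) * ε) * A) := Finset.sum_le_sum fun i _ => hbond i
      _ = N * (Kj * (2 * (C / c) * ((N : ℝ) * ε) * A)) := by simp
  refine hsum.trans (le_of_eq ?_)
  rw [hKj]
  ring

end Pinned

/-! ## §3 (UA) from uniform exponential convergence near equilibrium -/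

section Uniform

variable {ω₂ lam β γ : ℝ}

/-- **(UA) from (UEC).** Parameters `> 0`, `T > 0`, `N`, the unique deterministic weak steady family
`μ0`; (UEC): a weight `θ > 0`, a width `0 < δ₀ ≤ T` with `θ(2T+δ₀) ≤ 1`, and `C ≥ 0`, `c > 0` such
that for every `|δ| < δ₀` every invariant probability measure `μ` of the flip-free transition kernels
at `(T+δ/2, T-δ/2)` obeys `|P_t f(z) - μ(f)| ≤ C e^{θH(z)} e^{-ct}` (continuous `|f| ≤ e^{θH}`). Then
the conclusion of stub S2a holds with `K = 2(C/c)N²K_j(θ)`, `ε₀ = min(1/N, 1/(2(C/c)N+1))`, the same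
`δ₀`: `θ ≤ 1/(2T+δ₀) ≤ θ_δ`, so the stub's asymmetry hypothesis (class at `θ_δ`) implies the one at
`θ`, and `exists_flipSteadyState_totalCurrent_sub_le_of_expConvergence` applies (`N ≤ 1`: no current). -/
theorem uniformAsymmetryTransfer_of_uniformExpConvergence (hω : 0 < ω₂) (hl : 0 < lam) (hβ : 0 < β)
    (hγ : 0 < γ) {T : ℝ} (hT : 0 < T) (N : ℕ) (μ0 : ℝ → ℝ → Measure (PhaseSpace N))
    (hμ0 : ∀ T_L T_R : ℝ, 0 < T_L → 0 < T_R →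
      (pinnedChain ω₂ lam β γ).IsSteadyState N T_L T_R (μ0 T_L T_R) ∧
        ∀ ν : Measure (PhaseSpace N),
          (pinnedChain ω₂ lam β γ).IsSteadyState N T_L T_R ν → ν = μ0 T_L T_R)
    (hUEC : ∃ θ δ₀ C c : ℝ, 0 < θ ∧ 0 < δ₀ ∧ δ₀ ≤ T ∧ θ * (2 * T + δ₀) ≤ 1 ∧ 0 ≤ C ∧ 0 < c ∧
      ∀ δ : ℝ, |δ| < δ₀ →
        ∀ μ : Measure (PhaseSpace N), IsProbabilityMeasure μ →
          (∀ t : ℝ≥0, μ.bind ((pinnedChain ω₂ lam β γ).transitionKernel N (T + δ / 2) (T - δ / 2) t) = μ) →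
          ∀ (z : PhaseSpace N) (t : ℝ≥0) (f : PhaseSpace N → ℝ), Continuous f →
            (∀ y, |f y| ≤ Real.exp (θ * (pinnedChain ω₂ lam β γ).hamiltonian N y)) →
            |∫ y, f y ∂((pinnedChain ω₂ lam β γ).transitionKernel N (T + δ / 2) (T - δ / 2) t z) -
                ∫ y, f y ∂μ| ≤
              C * Real.exp (θ * (pinnedChain ω₂ lam β γ).hamiltonian N z) * Real.exp (-c * t)) :
    ∃ K ε₀ δ₀ : ℝ, 0 < ε₀ ∧ 0 < δ₀ ∧ ∀ δ : ℝ, δ ≠ 0 → |δ| < δ₀ → ∀ A : ℝ, 0 ≤ A →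
      (∀ (i : Fin N) (h : PhaseSpace N → ℝ), Continuous h →
        (∀ y, |h y| ≤ Real.exp (1 / max (T + δ / 2) (T - δ / 2) / 2 *
          (pinnedChain ω₂ lam β γ).hamiltonian N y)) →
        |∫ y, h (momentumFlip i y) ∂(μ0 (T + δ / 2) (T - δ / 2)) -
            ∫ y, h y ∂(μ0 (T + δ / 2) (T - δ / 2))| ≤ A) →
      ∀ ε : ℝ, 0 < ε → ε ≤ ε₀ →
        ∃ μ : Measure (PhaseSpace N),
          (pinnedChain ω₂ lam β γ).IsFlipSteadyState N (T + δ / 2) (T - δ / 2) ε μ ∧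
            |(pinnedChain ω₂ lam β γ).totalCurrent μ -
                (pinnedChain ω₂ lam β γ).totalCurrent (μ0 (T + δ / 2) (T - δ / 2))| ≤ K * ε * A := by
  set P := pinnedChain ω₂ lam β γ with hPdef
  obtain ⟨θ, δ₀, C, c, hθ, hδ₀, hδ₀T, hθT, hC, hc, h25⟩ := hUEC
  -- positivity of the temperatures and the comparison of the weights, for `|δ| < δ₀`
  have htemp : ∀ δ : ℝ, |δ| < δ₀ → 0 < T + δ / 2 ∧ 0 < T - δ / 2 ∧
      θ < 1 / max (T + δ / 2) (T - δ / 2) ∧ θ ≤ 1 / max (T + δ / 2) (T - δ / 2) / 2 := by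
    intro δ hδ
    have h1 := abs_lt.1 hδ
    have hTL : 0 < T + δ / 2 := by linarith
    have hTR : 0 < T - δ / 2 := by linarith
    have hmax : 0 < max (T + δ / 2) (T - δ / 2) := lt_max_of_lt_left hTL
    have hmaxle : max (T + δ / 2) (T - δ / 2) ≤ T + δ₀ / 2 := max_le (by linarith) (by linarith)
    have h2 : θ * max (T + δ / 2) (T - δ / 2) ≤ 1 / 2 := by nlinarith
    refine ⟨hTL, hTR, ?_, ?_⟩
    · rw [lt_div_iff₀ hmax]; linarith
    · rw [le_div_iff₀ (by norm_num : (0 : ℝ) < 2), le_div_iff₀ hmax]; linarith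
  rcases Nat.lt_or_ge N 2 with hN2 | hN2
  · -- no bond: both currents vanish; a flip steady state exists (`N = 0`: point mass; `N = 1`: Gibbs)
    refine ⟨0, 1, δ₀, one_pos, hδ₀, fun δ _ hδ A hA _ ε hε _ => ?_⟩
    obtain ⟨hTL, hTR, -, -⟩ := htemp δ hδ
    obtain ⟨μ, hμ⟩ : ∃ μ : Measure (PhaseSpace N), P.IsFlipSteadyState N (T + δ / 2) (T - δ / 2) ε μ := by
      interval_cases N
      · exact ⟨Measure.dirac default, P.isFlipSteadyState_zero_sites _ _ ε⟩
      · exact ⟨_, pinnedChain_isFlipSteadyState_gibbsMeasure_one hω hl.le hβ.le γ hTL hTR ε⟩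
    refine ⟨μ, hμ, ?_⟩
    rw [totalCurrent_eq_zero_of_le_one P (by omega) μ,
      totalCurrent_eq_zero_of_le_one P (by omega) (μ0 _ _), sub_zero, abs_zero, zero_mul, zero_mul]
  have hN : 1 < N := hN2
  refine ⟨2 * (C / c) * N * (N * (N * ((3 + β) / 2) * (2 * Real.exp θ / θ ^ 2))),
    min (1 / (N : ℝ)) (1 / (2 * (C / c) * N + 1)), δ₀, lt_min (by positivity) (by positivity), hδ₀,
    fun δ _ hδ A hA hasym ε hε hεle => ?_⟩
  obtain ⟨hTL, hTR, hθ', hθle⟩ := htemp δ hδ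
  -- the asymmetry hypothesis at the smaller weight `θ`
  have hasym' : ∀ (i : Fin N) (h : PhaseSpace N → ℝ), Continuous h →
      (∀ y, |h y| ≤ Real.exp (θ * P.hamiltonian N y)) →
      |∫ y, h (momentumFlip i y) ∂(μ0 (T + δ / 2) (T - δ / 2)) -
          ∫ y, h y ∂(μ0 (T + δ / 2) (T - δ / 2))| ≤ A := by
    intro i h hh hhb
    refine hasym i h hh fun y => (hhb y).trans (Real.exp_le_exp.2 ?_)
    exact mul_le_mul_of_nonneg_right hθle (pinnedChain_hamiltonian_nonneg hω.le hl.le hβ.le γ N y)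
  exact exists_flipSteadyState_totalCurrent_sub_le_of_expConvergence hω hl hβ hγ hN hTL hTR hθ hθ' hC hc
    (h25 δ hδ) (μ0 _ _) (hμ0 _ _ hTL hTR) A hA hasym' ε hε hεle

end Uniform


/-- Registered helper sub-goal `helper_uniformExpConvergenceTransfer` of stmt-AtomisticToContinuum-11976
(= `uniformAsymmetryTransfer_of_uniformExpConvergence`, fully quantified, notation-free one-line form):
stub S2a (UA) follows from temperature-uniform exponential convergence (2.5) of the flip-free chain near
equilibrium. -/
theorem helper_uniformExpConvergenceTransfer : ∀ (ω₂ lam β γ : ℝ), 0 < ω₂ → 0 < lam → 0 < β → 0 < γ → ∀ (T : ℝ), 0 < T → ∀ (N : ℕ) (μ0 : ℝ → ℝ → MeasureTheory.Measure (Literature.MathematicalPhysics.KineticTheory.HeatConduction.PhaseSpace N)), (∀ T_L T_R : ℝ, 0 < T_L → 0 < T_R → (Literature.MathematicalPhysics.KineticTheory.HeatConduction.pinnedChain ω₂ lam β γ).IsSteadyState N T_L T_R (μ0 T_L T_R) ∧ ∀ ν : MeasureTheory.Measure (Literature.MathematicalPhysics.KineticTheory.HeatConduction.PhaseSpace N),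 (Literature.MathematicalPhysics.KineticTheory.HeatConduction.pinnedChain ω₂ lam β γ).IsSteadyState N T_L T_R ν → ν = μ0 T_L T_R) → (∃ θ δ₀ C c : ℝ, 0 < θ ∧ 0 < δ₀ ∧ δ₀ ≤ T ∧ θ * (2 * T + δ₀) ≤ 1 ∧ 0 ≤ C ∧ 0 < c ∧ ∀ δ : ℝ, |δ| < δ₀ → ∀ μ : MeasureTheory.Measure (Literature.MathematicalPhysics.KineticTheory.HeatConduction.PhaseSpace N), MeasureTheory.IsProbabilityMeasure μ → (∀ t : NNReal, μ.bind ((Literature.MathematicalPhysics.KineticTheory.HeatConduction.pinnedChain ω₂ lam β γ).transitionKernel N (T + δ / 2) (T - δ / 2) t) = μ) → ∀ (z : Literature.MathematicalPhysics.KineticTheory.HeatConduction.PhaseSpace N) (t : NNReal) (f : Literature.MathematicalPhysics.KineticTheory.HeatConduction.PhaseSpace N → ℝ), Continuous f → (∀ y, |f y| ≤ Real.exp (θ * (Literature.MathematicalPhysics.KineticTheory.HeatConduction.pinnedChain ω₂ lam β γ).hamiltonian N y)) → |MeasureTheory.integral ((Literature.MathematicalPhysics.KineticTheory.HeatConduction.pinnedChain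 ω₂ lam β γ).transitionKernel N (T + δ / 2) (T - δ / 2) t z) (fun y => f y) - MeasureTheory.integral μ (fun y => f y)| ≤ C * Real.exp (θ * (Literature.MathematicalPhysics.KineticTheory.HeatConduction.pinnedChain ω₂ lam β γ).hamiltonian N z) * Real.exp (-c * (t : ℝ))) → ∃ K ε₀ δ₀ : ℝ, 0 < ε₀ ∧ 0 < δ₀ ∧ ∀ δ : ℝ, δ ≠ 0 → |δ| < δ₀ → ∀ A : ℝ, 0 ≤ A → (∀ (i : Fin N) (h : Literature.MathematicalPhysics.KineticTheory.HeatConduction.PhaseSpace N → ℝ), Continuous h → (∀ y, |h y| ≤ Real.exp (1 / max (T + δ / 2) (T - δ / 2) / 2 * (Literature.MathematicalPhysics.KineticTheory.HeatConduction.pinnedChain ω₂ lam β γ).hamiltonian N y)) → |MeasureTheory.integral (μ0 (T + δ / 2) (T - δ / 2)) (fun y => h (Literature.MathematicalPhysics.KineticTheory.HeatConduction.momentumFlip i y)) - MeasureTheory.integral (μ0 (T + δ / 2) (T - δ / 2)) (fun y => h y)| ≤ A) → ∀ ε : ℝ, 0 < ε → ε ≤ ε₀ → ∃ μ : MeasureTheory.Measure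 (Literature.MathematicalPhysics.KineticTheory.HeatConduction.PhaseSpace N), (Literature.MathematicalPhysics.KineticTheory.HeatConduction.pinnedChain ω₂ lam β γ).IsFlipSteadyState N (T + δ / 2) (T - δ / 2) ε μ ∧ |(Literature.MathematicalPhysics.KineticTheory.HeatConduction.pinnedChain ω₂ lam β γ).totalCurrent μ - (Literature.MathematicalPhysics.KineticTheory.HeatConduction.pinnedChain ω₂ lam β γ).totalCurrent (μ0 (T + δ / 2) (T - δ / 2))| ≤ K * ε * A :=
  fun _ _ _ _ hω hl hβ hγ _ hT N μ0 hμ0 hUEC =>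
    uniformAsymmetryTransfer_of_uniformExpConvergence hω hl hβ hγ hT N μ0 hμ0 hUEC

end Summit.AtomisticToContinuum.FouriersLaw.Theorems.FixedLengthNoiseContinuity

end
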